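import Mathlib
import HarnessLib

/-!
# Markman 2025 — §3.2 (v2 p. 25 L12–32): «`g_I` is symmetric» and «`f^*Ξ_P = dΞ_P`» (proof of COROLLARY 3.2.3),
# with «`I⁻¹ = −I`, hence `I` is anti-self-dual» (p. 19 L61–62) and «`f ∘ I` is self-dual … the symmetric bilinear
# form `g_P`» (p. 20 L3–5), and LEMMA 4.0.2's «g_{I₁}(x, y) = g_I(h⁻¹(x), h⁻¹(y))» (p. 26 L40–47) — the printed
# one-line deductions, kernel-checked for arbitrary operators

E. Markman: [M] *Cycles on abelian 2n-folds of Weil type from secant sheaves on abelian n-folds*,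
arXiv:2502.03415 **v2**, bib `Markman2025SecantWeil` — UNREFEREED PREPRINT. «v2 p. N L m» = PyMuPDF line `m` of PDF
page `N` of the public arXiv PDF (sha256/16 `8155aa33870069b8`); read BY EYE at seat lit-w-markman g16 (pub-hsemireg
LIT-W, 2026-08-24) on the 160-dpi renders `r_mar25v2_p25_gI_cor323.png` (`a4d875822fdb265e`),
`r_mar25v2_p19_I_antiselfdual.png` (`fbee3233128304ea`), `r_mar25v2_p20_top_fI.png` (`d20901e82fc3d415`) in
`HOME/lit/Markman-renders-litw-markman-g16/`.

## What is printed (verbatim, by eye)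

* v2 p. 19 L61–62: «The complex structure `I := I_{V_ℝ}` is an isometry⁸ of `V_ℝ` satisfying `I⁻¹ = −I`, hence `I` is
  anti-self-dual with respect to the pairing on `V_ℝ`.»
* v2 p. 20 L3–5: «Furthermore, `I` commutes with `f`, by Lemma 2.2.6. Hence, `Ξ_P` is of Hodge-type (1, 1) and `f ∘ I`
  is self-dual. We get the symmetric bilinear form on `V_ℝ` given by `g_P(x, y) := Ξ_P(I(x), y) = (f(I(x)), y)_V`.»
* v2 p. 25 L12–22: «Given `x, y ∈ V_ℝ` and `Ĩ ∈ Spin(V_ℝ)_w`, such that `I := ρ(Ĩ)` is a complex structure on `V_ℝ` as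
  in Corollary 3.2.2, set `Ξ_P(x, y) := (f(x), y)_V`, `g_I(x, y) := Ξ_P(x, I(y)) = (f(x), I(y))_V`. The automorphisms
  `I` and `f` of `V_ℝ` commute and both are anti-self-dual with respect to the symmetric bilinear pairing `(•, •)_V` on
  `V_ℝ`. Hence, `g_I` is symmetric:
  `g_I(y, x) = (f(y), I(x))_V = −(y, f(I(x)))_V = −(y, I(f(x)))_V = (I(y), f(x))_V = g_I(x, y)`.»
* COROLLARY 3.2.3 (v2 p. 25 L23–25): «If the bilinear form `g_I` is positive definite, then the rational (1, 1) class
  `Ξ_P(x, y)` is a Kähler class, and so the complex torus `(V_ℝ/V_ℤ, I, Ξ_P)` is a polarized abelian variety of Weil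
  type.»  PROOF (p. 25 L26–31): «Set `A := V_ℝ/V_ℤ`, endowed with the complex structure `I`. Consider the embedding
  `K ↪ End_ℚ(A)`, which sends `√−d` to `f`, given in (2.4.1). Then
  `f^*Ξ_P(x, y) := Ξ_P(f(x), f(y)) = (f²(x), f(y))_V = −(f³(x), y)_V = d(f(x), y) = dΞ_P(x, y)`,
  verifying the condition on the polarization in [vG1, Def. 4.9].»

## What this file proves (kernel-checked one-line deductions; theorems only — no def, no named fact, no sorry)

MODEL. `F` a field (`ℝ` or `ℚ`), `V` an `F`-space, `B : V →ₗ V →ₗ F` the pairing `(•, •)_V` (symmetry `hB` where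
used), endomorphisms `f`, `I` with the printed properties as hypotheses: `hf`/`hI` anti-self-duality (`B (f x) y =
−B x (f y)`), `hc` («`I` and `f` commute»), `hf2` (`f² = −d`, i.e. `f (f x) = −d·x`), `hiso`/`hI2` (`I` an isometry with
`I² = −𝟙`, i.e. «`I⁻¹ = −I`»). `Ξ_P(x, y)` is written `B (f x) y` and `g_I(x, y)` is written `B (f x) (I y)` (no new
definitions; (2.4.2) `Ξ_P` is `ProductDiscriminant.WeilFormXi` territory in `ProductWeilTypeDiscriminant.lean`, whose
`anti_self_dual` derives `hf` from `(f x, f y)_V = d(x, y)_V` and `f² = −d`).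
THEOREMS (each `=` of the printed chains is one `calc` step): `antiSelfDual_of_isometry_sq_neg_one` (p. 19 L61–62),
`fI_selfDual` («`f ∘ I` is self-dual», p. 20 L4), `gP_symm` («the symmetric bilinear form `g_P(x, y) := (f(I(x)), y)_V`»,
p. 20 L4–5 — the operator form; the coordinate form on the four-part decomposition is `EtaSimilarity.gP_symm` in
`EtaSimilarityWeilPolarization.lean`), `gI_symm` (p. 25 L20–22, the four printed equalities), `xi_pullback_f` (p. 25 L30,
«`Ξ_P(f(x), f(y)) = (f²(x), f(y))_V = −(f³(x), y)_V = d(f(x), y) = dΞ_P(x, y)`»).  BY VALUE / NOT formalised: `X`,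
`Spin(V_ℝ)_w`, `ρ`, Hodge types, Lemma 2.2.6 (that `I` commutes with `f`), Corollary 3.2.2, positivity of `g_I`, «Kähler
class», the torus `V_ℝ/V_ℤ` and [vG1, Def. 4.9] — COROLLARY 3.2.3 itself is NOT asserted; only the displayed identity of
its proof is.  Section `Conjugation402` adds LEMMA 4.0.2's proof, FIRST DISPLAY (v2 p. 26 L40–47, «`g_{I₁}(x, y) = … =
g_I(h⁻¹(x), h⁻¹(y))`. Hence, `g_{I₁}` is positive definite as well», `I₁ := hIh⁻¹`): `inv_comm_f`, `conj_comm_f`,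
`conj_sq_neg`/`conj_sq_neg'`, `gI_conj` (the four printed equalities), `gI_conj_posDef` (positivity transport over an
ordered field); the orbit statement of LEMMA 4.0.2 and its dimension count are NOT asserted here (the count is
`WeilPeriodDomainDimension.lean`).  Honest framing (pub-hsemireg): printed linear algebra re-checked; nothing here bears on the Hodge conjecture
or re-proves a theorem of [M].
-/

namespace Literature.AlgebraicGeometry.Markman2025

namespace Polarization32

variable {F : Type*} [Field F] {V : Type*} [AddCommGroup V] [Module F V]
variable (B : V →ₗ[F] V →ₗ[F] F) (f I : V →ₗ[F] V) (d : F)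

/-- «`I` … is an isometry of `V_ℝ` satisfying `I⁻¹ = −I`, hence `I` is anti-self-dual with respect to the pairing»:
`(I x, I y) = (x, y)` and `I(I y) = −y` give `(I x, y) = −(x, I y)`. [cite: Markman2025SecantWeil, §2.4, v2 p. 19 L61–62] -/
theorem antiSelfDual_of_isometry_sq_neg_one (hiso : ∀ x y, B (I x) (I y) = B x y) (hI2 : ∀ y, I (I y) = -y)
    (x y : V) : B (I x) y = -B x (I y) := by
  have h := hiso x (I y)
  rw [hI2, map_neg] at h
  rw [← h, neg_neg]

/-- «`I` commutes with `f` … Hence … `f ∘ I` is self-dual»: `(f(I(x)), y) = (x, f(I(y)))` for `f`, `I` anti-self-dual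
and commuting. [cite: Markman2025SecantWeil, §2.4, v2 p. 20 L3–4] -/
theorem fI_selfDual (hf : ∀ x y, B (f x) y = -B x (f y)) (hI : ∀ x y, B (I x) y = -B x (I y))
    (hc : ∀ x, f (I x) = I (f x)) (x y : V) : B (f (I x)) y = B x (f (I y)) := by
  calc B (f (I x)) y = -B (I x) (f y) := hf (I x) y
    _ = B x (I (f y)) := by rw [hI x (f y), neg_neg]
    _ = B x (f (I y)) := by rw [hc]

/-- «We get the symmetric bilinear form on `V_ℝ` given by `g_P(x, y) := Ξ_P(I(x), y) = (f(I(x)), y)_V`»: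
`(f(I(x)), y) = (f(I(y)), x)` for `(•, •)_V` symmetric — the operator form of `EtaSimilarity.gP_symm`.
[cite: Markman2025SecantWeil, §2.4, v2 p. 20 L4–5] -/
theorem gP_symm (hB : ∀ x y, B x y = B y x) (hf : ∀ x y, B (f x) y = -B x (f y))
    (hI : ∀ x y, B (I x) y = -B x (I y)) (hc : ∀ x, f (I x) = I (f x)) (x y : V) :
    B (f (I x)) y = B (f (I y)) x := by
  rw [fI_selfDual B f I hf hI hc x y, hB]

/-- «Hence, `g_I` is symmetric: `g_I(y, x) = (f(y), I(x))_V = −(y, f(I(x)))_V = −(y, I(f(x)))_V = (I(y), f(x))_V =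
g_I(x, y)`» — `g_I(x, y) := (f(x), I(y))_V`; the four printed equalities, for `(•, •)_V` symmetric, `f`, `I`
anti-self-dual and commuting. [cite: Markman2025SecantWeil, §3.2, v2 p. 25 L17–22] -/
theorem gI_symm (hB : ∀ x y, B x y = B y x) (hf : ∀ x y, B (f x) y = -B x (f y))
    (hI : ∀ x y, B (I x) y = -B x (I y)) (hc : ∀ x, f (I x) = I (f x)) (x y : V) :
    B (f y) (I x) = B (f x) (I y) := by
  calc B (f y) (I x) = -B y (f (I x)) := hf y (I x)
    _ = -B y (I (f x)) := by rw [hc]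
    _ = B (I y) (f x) := by rw [hI y (f x)]
    _ = B (f x) (I y) := hB (I y) (f x)

/-- «`f^*Ξ_P(x, y) := Ξ_P(f(x), f(y)) = (f²(x), f(y))_V = −(f³(x), y)_V = d(f(x), y) = dΞ_P(x, y)`» — with
`Ξ_P(x, y) = (f(x), y)_V`, `f` anti-self-dual and `f² = −d`: the multiplier of `f` on `Ξ_P` is `d`, «verifying the
condition on the polarization in [vG1, Def. 4.9]» (by value). [cite: Markman2025SecantWeil, Corollary 3.2.3 (proof), v2 p. 25 L26–31] -/
theorem xi_pullback_f (hf : ∀ x y, B (f x) y = -B x (f y)) (hf2 : ∀ x, f (f x) = -(d • x)) (x y : V) :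
    B (f (f x)) (f y) = d * B (f x) y := by
  calc B (f (f x)) (f y) = -B (f (f (f x))) y := by rw [hf (f (f x)) y, neg_neg]
    _ = d * B (f x) y := by
        rw [hf2 (f x), map_neg, LinearMap.neg_apply, neg_neg, map_smul, LinearMap.smul_apply, smul_eq_mul]

/-! ### LEMMA 4.0.2, proof, first display (v2 p. 26 L40–47): conjugating `I` by an isometry `h` commuting with
`f` transports `g_I` — «Set `I₁ := hIh⁻¹`, for some `h ∈ SO₊(V_ℝ)_f` and `I ∈ Ω_P`. Then `f` commutes with `I` and `h`
and so `g_{I₁}(x, y) = Ξ_P(x, I₁(y)) = (f(x), hIh⁻¹(y))_V = (h⁻¹(f(x)), I(h⁻¹(y)))_V = (f(h⁻¹(x)), I(h⁻¹(y)))_V =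
g_I(h⁻¹(x), h⁻¹(y))`. Hence, `g_{I₁}` is positive definite as well.» (read BY EYE at lit-w-markman g19 on the render
`r_mar25v2_p26_lemma402_first.png` `3a3bb7565a99f6e0` in `HOME/lit/Markman-renders-litw-markman-g19/`; pre-filing
statement read ×2 across seats — lit-3 g55, cell bus l.18285: CONCUR).
`h⁻¹` is an explicit two-sided inverse `hinv` (hypotheses `hh`, `hh'`); «`h ∈ SO₊(V_ℝ)_f`» enters only as «`h` is an
isometry of `(•, •)_V` commuting with `f`» (`hiso`, `hcf`); `SO₊`, `Ω_P` and the orbit statement are BY VALUE. -/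

section Conjugation402

variable (h hinv : V →ₗ[F] V)

/-- `h⁻¹` commutes with `f` when `h` does. [cite: Markman2025SecantWeil, Lemma 4.0.2 (proof), v2 p. 26 L40–41] -/
theorem inv_comm_f (hh : ∀ x, h (hinv x) = x) (hh' : ∀ x, hinv (h x) = x) (hcf : ∀ x, h (f x) = f (h x)) (x : V) :
    hinv (f x) = f (hinv x) := by
  have e := hcf (hinv x)
  rw [hh] at e
  rw [← e, hh']

/-- «Then `f` commutes with `I` and `h` and so» `f` commutes with `I₁ = hIh⁻¹`.
[cite: Markman2025SecantWeil, Lemma 4.0.2 (proof), v2 p. 26 L40–41] -/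
theorem conj_comm_f (hh : ∀ x, h (hinv x) = x) (hh' : ∀ x, hinv (h x) = x) (hcf : ∀ x, h (f x) = f (h x))
    (hc : ∀ x, f (I x) = I (f x)) (y : V) : f (h (I (hinv y))) = h (I (hinv (f y))) := by
  rw [← hcf, hc, ← inv_comm_f f h hinv hh hh' hcf]

/-- `I₁ = hIh⁻¹` is again a complex structure: `I₁(I₁(y)) = −y` when `I(I(y)) = −y`.
[cite: Markman2025SecantWeil, Lemma 4.0.2 (proof), v2 p. 26 L40] -/
theorem conj_sq_neg (hh' : ∀ x, hinv (h x) = x) (hI2 : ∀ y, I (I y) = -y) (y : V) :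
    h (I (hinv (h (I (hinv y))))) = -(h (hinv y)) := by
  rw [hh', hI2, map_neg]

/-- The transported vector: `I₁(I₁(y)) = −y`. [cite: Markman2025SecantWeil, Lemma 4.0.2 (proof), v2 p. 26 L40] -/
theorem conj_sq_neg' (hh : ∀ x, h (hinv x) = x) (hh' : ∀ x, hinv (h x) = x) (hI2 : ∀ y, I (I y) = -y) (y : V) :
    h (I (hinv (h (I (hinv y))))) = -y := by
  rw [conj_sq_neg I h hinv hh' hI2, hh]

/-- THE DISPLAY «`g_{I₁}(x, y) = Ξ_P(x, I₁(y)) = (f(x), hIh⁻¹(y))_V = (h⁻¹(f(x)), I(h⁻¹(y)))_V =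
(f(h⁻¹(x)), I(h⁻¹(y)))_V = g_I(h⁻¹(x), h⁻¹(y))`» — each printed `=` one `calc` step; `h` an isometry with two-sided
inverse `h⁻¹` commuting with `f`. [cite: Markman2025SecantWeil, Lemma 4.0.2 (proof), v2 p. 26 L42–46] -/
theorem gI_conj (hh : ∀ x, h (hinv x) = x) (hh' : ∀ x, hinv (h x) = x) (hiso : ∀ x y, B (h x) (h y) = B x y)
    (hcf : ∀ x, h (f x) = f (h x)) (x y : V) :
    B (f x) (h (I (hinv y))) = B (f (hinv x)) (I (hinv y)) := by
  calc B (f x) (h (I (hinv y))) = B (hinv (f x)) (I (hinv y)) := by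
        conv_lhs => rw [← hh (f x)]
        rw [hiso]
    _ = B (f (hinv x)) (I (hinv y)) := by rw [inv_comm_f f h hinv hh hh' hcf]

/-- «Hence, `g_{I₁}` is positive definite as well»: over an ordered field, if `g_I(x, x) > 0` for all `x ≠ 0` then
`g_{I₁}(x, x) > 0` for all `x ≠ 0` (`h⁻¹` is injective). [cite: Markman2025SecantWeil, Lemma 4.0.2 (proof), v2 p. 26 L47] -/
theorem gI_conj_posDef {F : Type*} [Field F] [LinearOrder F] [IsStrictOrderedRing F] {V : Type*} [AddCommGroup V]
    [Module F V] (B : V →ₗ[F] V →ₗ[F] F) (f I h hinv : V →ₗ[F] V)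
    (hh : ∀ x, h (hinv x) = x) (hh' : ∀ x, hinv (h x) = x) (hiso : ∀ x y, B (h x) (h y) = B x y)
    (hcf : ∀ x, h (f x) = f (h x)) (hpos : ∀ x, x ≠ 0 → 0 < B (f x) (I x)) (x : V) (hx : x ≠ 0) :
    0 < B (f x) (h (I (hinv x))) := by
  rw [gI_conj B f I h hinv hh hh' hiso hcf]
  apply hpos
  intro h0
  apply hx
  rw [← hh x, h0, map_zero]

end Conjugation402

end Polarization32

end Literature.AlgebraicGeometry.Markman2025
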